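import Summits.Ventures.YMGap.RobustBall.MassGapOnBallMassiveQuarter
import Summits.Ventures.YMGap.RobustBall.MassGapOnBallMassiveRows
import Summits.Ventures.YMGap.RobustBall.MassGapOnBallZdG
import HarnessLib

/-!
# Venture YMGap, track ROBUST-BALL — the GAUGE-INVARIANT tier-1 `ℤ^d` ball `MemBallZdG`: mass gap on the ball
# ⇒ every DLR state of every member is MASSIVE

HONEST FRAMING. WHAT THIS IS: a venture file (cell `pub-ymgap`, track Y2 ROBUST-BALL, seat ds-3): the
massive-currency reading of ds-2's gauge-invariant tier-1 `ℤ^d` ball (`MassGapOnBallZdG.lean`, crux Y2-X2-Zd).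
A member `(W, supp) ∈ MemBallZdG ε₀ ε₁ R` is a member of rb-p1's ball `MemBallZd ε₀ ε₁ R` (`MemBallZdG.memBallZd`),
so the seat's conversion «`PerturbedMassGapAt` at a member ⇒ DLR states exist and EVERY DLR state is an
Osterwalder–Seiler MASSIVE STATE (`IsMassiveState`: one rate for all truncated correlations of bounded measurable
local observables) with exponentially decaying plaquette–plaquette correlation function»
(`massive_of_perturbedMassGapAt`, `MassGapOnBallMassiveRows.lean`; every-`d` clause
`massiveClause_of_perturbedMassGapAt`, `MassGapOnBallMassiveQuarter.lean`) applies verbatim: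
`massive_onBallZdG` (`d = 4`: `MassGapOnBallZdG 4 N β ε₀ ε₁ R` ⇒ every member massive), `massiveClause_onBallZdG`
(every `d ≥ 1`), the Wilson-coupling reading for `SU(2)` (`su2_isMassiveState_onBallZdG_wilson`), and the transfer
of every landed `MassGapOnBallZd` row to the gauge-invariant ball in the massive currency
(`massive_onBallZdG_of_massGapOnBallZd`). When ds-2's robust vertex-star door on `ℤ^d`
(`massGapOnBallZdG_of_robustStar`) and its cells land, each cell `MassGapOnBallZdG 4 2 (β_W/4) ε₀ ε₁ R` is at once
an every-DLR-state-massive row by `massive_onBallZdG`. WHAT IT IS NOT: kernel composition only — no door, no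
row, no number; nothing about the continuum limit, confinement or the Clay Millennium problem.

References: ds-2 `MassGapOnBallZdG.lean`; ds-3 `MassGapOnBallMassive.lean`, `MassGapOnBallMassiveRows.lean`,
`MassGapOnBallMassiveQuarter.lean`, `PerturbedMassiveBridge.lean`; K. Osterwalder, E. Seiler, Ann. Phys. 110
(1978) 440, §4.
-/

noncomputable section

open MeasureTheory ProbabilityTheory Function Finset Filter Topology
open scoped NNReal
open Literature.Probability.LatticeModels
open Literature.MathematicalPhysics.QuantumLattice
open Literature.MathematicalPhysics.QuantumFieldTheory hiding ZdEdge Site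
open Literature.Barriers.QuantumFields (IsMassiveState)

namespace Summit.Ventures.YMGap.RobustBall

variable {d N : ℕ}

/-- **Member level**: `PerturbedMassGapAt 4 N β W supp` at a member `(W, supp)` of a gauge-invariant ball
`MemBallZdG ε₀ ε₁ R` (`N ≥ 1`) gives: DLR states exist and every DLR state is MASSIVE with exponentially decaying
plaquette–plaquette correlation function. -/
theorem massive_of_memBallZdG (hN : 1 ≤ N) {β ε₀ ε₁ : ℝ} {R : ℕ}
    {W : Potential (ZdEdge 4) (Matrix.specialUnitaryGroup (Fin N) ℂ)}
    {supp : Finset (ZdEdge 4) → Finset (Finset (ZdEdge 4))} (hmem : MemBallZdG ε₀ ε₁ R W supp)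
    (h : PerturbedMassGapAt 4 N β W supp) :
    (perturbedGibbsMeasures (d := 4) (fundamentalRep (Fin N)) ((N : ℝ) * β) W supp).Nonempty ∧
      ∀ μ ∈ perturbedGibbsMeasures (d := 4) (fundamentalRep (Fin N)) ((N : ℝ) * β) W supp,
        IsMassiveState μ ∧ HasExponentialDecay (plaquetteCorrFn (fundamentalRep (Fin N)) μ) :=
  massive_of_perturbedMassGapAt hN hmem.memBallZd h

/-- ★ **MASS GAP ON THE GAUGE-INVARIANT `ℤ⁴` BALL ⇒ EVERY DLR STATE OF EVERY MEMBER IS MASSIVE**: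
`MassGapOnBallZdG 4 N β ε₀ ε₁ R` (`N ≥ 1`) gives, for every member `(W, supp) ∈ MemBallZdG ε₀ ε₁ R` — continuous,
adapted, locally finite, range-`R`, GAUGE-INVARIANT terms with oscillation load `ε₀` and site-incidence Lipschitz
load `ε₁` — added to `SU(N)` Wilson at 't Hooft coupling `β`: DLR states exist and every DLR state is an
Osterwalder–Seiler massive state with exponentially decaying plaquette–plaquette correlation function. -/
theorem massive_onBallZdG (hN : 1 ≤ N) {β ε₀ ε₁ : ℝ} {R : ℕ} (h : MassGapOnBallZdG 4 N β ε₀ ε₁ R)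
    {W : Potential (ZdEdge 4) (Matrix.specialUnitaryGroup (Fin N) ℂ)}
    {supp : Finset (ZdEdge 4) → Finset (Finset (ZdEdge 4))} (hmem : MemBallZdG ε₀ ε₁ R W supp) :
    (perturbedGibbsMeasures (d := 4) (fundamentalRep (Fin N)) ((N : ℝ) * β) W supp).Nonempty ∧
      ∀ μ ∈ perturbedGibbsMeasures (d := 4) (fundamentalRep (Fin N)) ((N : ℝ) * β) W supp,
        IsMassiveState μ ∧ HasExponentialDecay (plaquetteCorrFn (fundamentalRep (Fin N)) μ) :=
  massive_of_memBallZdG hN hmem (h W supp hmem)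

/-- **EVERY `d ≥ 1`: mass gap on the gauge-invariant `ℤ^d` ball ⇒ the Osterwalder–Seiler clause for every DLR state
of every member** — one rate `m` at which `cov_μ(F₁, F₂ ∘ θ_x)` decays exponentially for ALL bounded measurable local
observables (the body of `IsMassiveState` with `4 ↦ d`). -/
theorem massiveClause_onBallZdG (hd : 1 ≤ d) (hN : 1 ≤ N) {β ε₀ ε₁ : ℝ} {R : ℕ}
    (h : MassGapOnBallZdG d N β ε₀ ε₁ R)
    {W : Potential (ZdEdge d) (Matrix.specialUnitaryGroup (Fin N) ℂ)}
    {supp : Finset (ZdEdge d) → Finset (Finset (ZdEdge d))} (hmem : MemBallZdG ε₀ ε₁ R W supp) :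
    ∀ μ ∈ perturbedGibbsMeasures (d := d) (fundamentalRep (Fin N)) ((N : ℝ) * β) W supp,
      ∃ m : ℝ, ∀ F₁ F₂ : LGConfig d (Matrix.specialUnitaryGroup (Fin N) ℂ) → ℝ,
        Literature.MathematicalPhysics.QuantumLattice.IsLocalObservable F₁ →
        Literature.MathematicalPhysics.QuantumLattice.IsLocalObservable F₂ →
        Measurable F₁ → Measurable F₂ → (∃ C, ∀ U, |F₁ U| ≤ C) → (∃ C, ∀ U, |F₂ U| ≤ C) →
          HasExponentialDecayRate
            (fun x : Site d => cov[F₁, fun U => F₂ (Literature.MathematicalPhysics.QuantumLattice.configShift x U); μ]) m :=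
  massiveClause_of_perturbedMassGapAt hd hN hmem.memBallZd (h W supp hmem)

/-- **Every landed `MassGapOnBallZd` row is a massive row on the gauge-invariant ball** (`d = 4`, `N ≥ 1`): the
gauge-invariant ball is a sub-ball of rb-p1's, so `MassGapOnBallZd 4 N β ε₀ ε₁ R` gives every member of
`MemBallZdG ε₀ ε₁ R` DLR states, all massive with plaquette–plaquette decay. -/
theorem massive_onBallZdG_of_massGapOnBallZd (hN : 1 ≤ N) {β ε₀ ε₁ : ℝ} {R : ℕ}
    (h : MassGapOnBallZd 4 N β ε₀ ε₁ R)
    {W : Potential (ZdEdge 4) (Matrix.specialUnitaryGroup (Fin N) ℂ)}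
    {supp : Finset (ZdEdge 4) → Finset (Finset (ZdEdge 4))} (hmem : MemBallZdG ε₀ ε₁ R W supp) :
    (perturbedGibbsMeasures (d := 4) (fundamentalRep (Fin N)) ((N : ℝ) * β) W supp).Nonempty ∧
      ∀ μ ∈ perturbedGibbsMeasures (d := 4) (fundamentalRep (Fin N)) ((N : ℝ) * β) W supp,
        IsMassiveState μ ∧ HasExponentialDecay (plaquetteCorrFn (fundamentalRep (Fin N)) μ) :=
  massive_onBallZdG hN (massGapOnBallZdG_of_massGapOnBallZd h) hmem

/-- **Wilson-coupling reading, `SU(2)`** (tree coupling `β_W/2`, 't Hooft slot `β_W/4`): under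
`MassGapOnBallZdG 4 2 (β_W/4) ε₀ ε₁ R`, every DLR state of `perturbedYM (fundamentalRep (Fin 2)) (β_W/2) W supp`,
`(W, supp) ∈ MemBallZdG ε₀ ε₁ R`, is massive with plaquette–plaquette decay. -/
theorem su2_isMassiveState_onBallZdG_wilson {βW ε₀ ε₁ : ℝ} {R : ℕ}
    (h : MassGapOnBallZdG 4 2 (βW / 4) ε₀ ε₁ R)
    {W : Potential (ZdEdge 4) (Matrix.specialUnitaryGroup (Fin 2) ℂ)}
    {supp : Finset (ZdEdge 4) → Finset (Finset (ZdEdge 4))} (hmem : MemBallZdG ε₀ ε₁ R W supp) :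
    ∀ μ ∈ perturbedGibbsMeasures (d := 4) (fundamentalRep (Fin 2)) (βW / 2) W supp,
      IsMassiveState μ ∧ HasExponentialDecay (plaquetteCorrFn (fundamentalRep (Fin 2)) μ) := by
  have e : ((2 : ℕ) : ℝ) * (βW / 4) = βW / 2 := by push_cast; ring
  rw [← e]
  exact (massive_onBallZdG (N := 2) (by norm_num) h hmem).2

end Summit.Ventures.YMGap.RobustBall

end
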